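import Summits.RiemannHypothesis.RiemannHypothesis.Theorems.HandoffCouplingCumulative
import HarnessLib

/-!
# The repaired coupling slot `CouplingPos(q)` (coupling demanded only for non-negative-energy `u`) is cumulative too

Cell `rh-explicit`, TRACK «HANDOFF», seat handoff-theory-1 (definitions + logic), gen2.  Companion text:
`HOME/handoff/HANDOFF-STATEMENT.md` §I (v1.2), the Edison-clause REPAIR CENSUS of the Schur form.  Builds on
`HandoffCouplingCumulative.lean` (this seat: `Coupling(q) ↔ H(q)`) and `HandoffSchur.lean` (prove-2).

HONEST FRAMING.  Nothing here is a step towards RH.  `HandoffCouplingCumulative.lean` shows that prove-2's coupling law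
`HandoffCoupling q q' η` CONTAINS the induction hypothesis `WeilPositivityOn((log q)/2)` (test it against a
positive-energy edge function).  The obvious repair is to demand the Cauchy–Schwarz inequality only for old-cone functions
`u` of NON-NEGATIVE energy — `HandoffCouplingPos` below; under the induction hypothesis it is the same law, and it is
RH-implied.  THIS FILE SHOWS THE REPAIR COLLAPSES AS WELL (`weilPositivityOn_of_handoffCouplingPos`,
`handoffCouplingPos_iff_handoffH`): for overlap `η > 0` the strip `[(log q)/2 − η, (log q)/2]` carries test functions
that are simultaneously old-cone and edge-layer; a positive-energy `ψ` there, the line `ψ + s·u₋` through a hypothetical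
negative-energy `u₋`, and the law at `(ψ + s u₋, ψ)` for small `s > 0` give `β²s² ≤ αc·s²` with `α < 0 < c` — absurd.
So `CouplingPos(q) ↔ H(q)` and `RH ↔ ∀ q prime, CouplingPos(q)`: within the Schur family (any law quantified over an
overlap strip of positive width) there is no per-window statement that is both non-vacuous for large `q` and weaker
than cumulative Weil positivity.  (The overlap is forced: a smooth `g` does not split as `u + h` with `u` supported in
`[−c′, c′]` and `h` vanishing on `(−c′, c′)`.)

References: Bombieri, Rend. Lincei (9) 11 (2000) §3, Thm 12 [Bombieri2000Weil]; this track: prove-2 ATTEMPT-2 (Schur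
blocks), HANDOFF-STATEMENT.md §I.
-/

set_option linter.dupNamespace false  -- the mandated namespace repeats `RiemannHypothesis`

noncomputable section

open Set MeasureTheory Metric Literature.NumberTheory.LFunctions
open scoped Topology

namespace Summit.RiemannHypothesis.RiemannHypothesis.Theorems.HandoffDecomposition

variable {q q' : ℕ} {η : ℝ}

/-! ## The repaired slot «coupling only for non-negative-energy `u`» and the overlap argument -/

/-- **`CouplingPos(q)`** — the natural REPAIR of the coupling law that does not obviously contain the induction
hypothesis: the Cauchy–Schwarz inequality `crossRe(u,h)² ≤ Re Q(u)·Re Q(h)` is demanded ONLY for old-cone functions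
`u ∈ C((log q)/2)` of non-negative energy `Re Q(u) ≥ 0` (and every edge-layer `h`).  Under the induction hypothesis
it coincides with `HandoffCoupling`; it is RH-implied; and (`handoffCouplingPos_iff_handoffH`) for `η > 0` it is
STILL equivalent to `H(q)` — the overlap strip `[(log q)/2 − η, (log q)/2]` carries functions that are at once
old-cone and edge-layer.  A statement of THIS track (the Edison-clause repair census, HANDOFF-STATEMENT.md §I.3), not a
literature fact. [this track (theory-1 gen2), HANDOFF-STATEMENT.md §I.3] -/
def HandoffCouplingPos (q q' : ℕ) (η : ℝ) : Prop :=
  ∀ b ∈ Icc (Real.log q / 2) (Real.log q' / 2), ∀ u h : ℝ → ℂ, IsWeilTest u →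
    tsupport u ⊆ Icc (-(Real.log q / 2)) (Real.log q / 2) → 0 ≤ (weilQuadratic u).re →
      Handoff.IsEdgeLayer q η b h → (Handoff.crossRe u h) ^ 2 ≤ (weilQuadratic u).re * (weilQuadratic h).re

/-- `Coupling → CouplingPos` (restriction). [folklore] -/
theorem handoffCouplingPos_of_handoffCoupling (h : Handoff.HandoffCoupling q q' η) :
    HandoffCouplingPos q q' η :=
  fun b hb u g hu hus _ hg ↦ h b hb u g hu hus hg

/-- Under the induction hypothesis `WeilPositivityOn((log q)/2)` the repaired and the original coupling laws
coincide. [folklore] -/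
theorem handoffCouplingPos_iff_handoffCoupling_of_weilPositivityOn (hIH : WeilPositivityOn (Real.log q / 2)) :
    HandoffCouplingPos q q' η ↔ Handoff.HandoffCoupling q q' η :=
  ⟨fun h b hb u g hu hus hg ↦ h b hb u g hu hus (hIH u hu hus) hg, handoffCouplingPos_of_handoffCoupling⟩

/-- `crossRe` is symmetric. [folklore] -/
theorem crossRe_comm (u h : ℝ → ℂ) : Handoff.crossRe u h = Handoff.crossRe h u := by
  unfold Handoff.crossRe
  rw [add_comm u h]
  ring

/-- The cross term of `ψ + s·v` against `ψ` along a real line: `crossRe(ψ + s v, ψ) = Re Q(ψ) + s·crossRe(ψ, v)`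
(polarisation: `(ψ + s v) + ψ = 2(ψ + (s/2) v)` and `Q(2g) = 4Q(g)`). [cite: Bombieri2000Weil, §3 (hermitian form)] -/
theorem crossRe_add_real_mul_self {ψ v : ℝ → ℂ} (hψ : IsWeilTest ψ) (hv : IsWeilTest v) (s : ℝ) :
    Handoff.crossRe (ψ + fun x ↦ (s : ℂ) * v x) ψ =
      (weilQuadratic ψ).re + s * Handoff.crossRe ψ v := by
  have h1 := Handoff.re_weilQuadratic_add_real_mul hψ hv s
  have h2 := Handoff.re_weilQuadratic_add_real_mul hψ hv (s / 2)
  have hsum : ((ψ + fun x ↦ (s : ℂ) * v x) + ψ) = fun x ↦ (2 : ℂ) * (ψ + fun x ↦ ((s / 2 : ℝ) : ℂ) * v x) x := by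
    funext x
    simp only [Pi.add_apply]
    push_cast
    ring
  have h3 : (weilQuadratic ((ψ + fun x ↦ (s : ℂ) * v x) + ψ)).re =
      4 * (weilQuadratic (ψ + fun x ↦ ((s / 2 : ℝ) : ℂ) * v x)).re := by
    rw [hsum, weilQuadratic_const_mul]
    simp [Complex.normSq]
    norm_num
  unfold Handoff.crossRe
  rw [h3, h2, h1]
  unfold Handoff.crossRe
  ring

/-- **The repaired coupling law is cumulative as well**: for `2 ≤ q < q'` and overlap `η > 0`,
`CouplingPos(q, q', η) → WeilPositivityOn((log q)/2)`.  Proof: if some `u₋ ∈ C((log q)/2)` had `Re Q(u₋) < 0`, take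
`ψ` of positive energy inside the overlap strip (old-cone AND edge-layer) and `s > 0` small with
`Re Q(ψ + s u₋) ≥ 0`; the law at `(ψ + s u₋, ψ)` reads `(c + βs)² ≤ (c + 2βs + αs²)c`, i.e. `β²s² ≤ αc s²` with
`α = Re Q(u₋) < 0 < c = Re Q(ψ)` — absurd. [this track (theory-1 gen2); Bombieri2000Weil §3, Thm. 12] -/
theorem weilPositivityOn_of_handoffCouplingPos (hq : 2 ≤ q) (hqq' : q < q') (hη : 0 < η)
    (hC : HandoffCouplingPos q q' η) : WeilPositivityOn (Real.log q / 2) := by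
  intro v hv hvs
  by_contra hneg
  rw [not_le] at hneg
  set α : ℝ := (weilQuadratic v).re with hα_def
  -- geometry of the window
  have hq0 : (0 : ℝ) < q := by exact_mod_cast (lt_of_lt_of_le (by norm_num : 0 < 2) hq)
  have hlq : 0 < Real.log q / 2 := by
    have := Real.log_pos (show (1 : ℝ) < q by exact_mod_cast hq); positivity
  have hle : Real.log q / 2 ≤ Real.log q' / 2 := by
    have := Real.log_le_log hq0 (show (q : ℝ) ≤ q' by exact_mod_cast hqq'.le); linarith
  have hlq' : 0 ≤ Real.log q' / 2 := le_trans hlq.le hle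
  -- ψ: positive energy inside the overlap strip [(log q)/2 − η₁, (log q)/2], η₁ = min η ((log q)/2)
  set η₁ : ℝ := min η (Real.log q / 2) with hη₁
  have hη₁pos : 0 < η₁ := lt_min hη hlq
  have hη₁η : η₁ ≤ η := min_le_left _ _
  have hη₁l : η₁ ≤ Real.log q / 2 := min_le_right _ _
  obtain ⟨ψ, hψ, hψs, hc⟩ := exists_isWeilTest_re_weilQuadratic_pos (Real.log q / 2 - η₁) hη₁pos
  have hψs' : tsupport ψ ⊆ Icc (Real.log q / 2 - η₁) (Real.log q / 2) :=
    hψs.trans (Icc_subset_Icc le_rfl (by linarith))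
  have hψcone : tsupport ψ ⊆ Icc (-(Real.log q / 2)) (Real.log q / 2) :=
    hψs'.trans (Icc_subset_Icc (by linarith) le_rfl)
  have hψedge : Handoff.IsEdgeLayer q η (Real.log q' / 2) ψ := by
    refine ⟨hψ, hψs'.trans (Icc_subset_Icc (by linarith) hle), fun x hx ↦ ?_⟩
    by_contra hne
    have hxs : x ∈ tsupport ψ := subset_tsupport _ (Function.mem_support.2 hne)
    have h1 : Real.log q / 2 - η₁ ≤ x := (hψs' hxs).1
    linarith [le_abs_self x]
  set c : ℝ := (weilQuadratic ψ).re with hc_def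
  set β : ℝ := Handoff.crossRe ψ v with hβ_def
  -- the small positive parameter
  set K : ℝ := 2 * |β| + |α| with hK
  have hK0 : 0 ≤ K := by positivity
  set s : ℝ := c / (c + K) with hs_def
  have hs0 : 0 < s := by positivity
  have hs1 : s ≤ 1 := by
    rw [hs_def, div_le_one (by positivity)]; linarith
  have hKs : K * s < c := by
    rw [hs_def, ← mul_div_assoc, div_lt_iff₀ (by positivity)]
    nlinarith
  -- u := ψ + s v is in the old cone and has non-negative energy
  set u : ℝ → ℂ := ψ + fun x ↦ (s : ℂ) * v x with hu_def
  have hsv : IsWeilTest (fun x ↦ (s : ℂ) * v x) := hv.const_mul (s : ℂ)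
  have hu : IsWeilTest u := hψ.add hsv
  have hus : tsupport u ⊆ Icc (-(Real.log q / 2)) (Real.log q / 2) := by
    refine (tsupport_add ψ _).trans (union_subset hψcone ?_)
    exact tsupport_mul_subset_right.trans hvs
  have hfu : (weilQuadratic u).re = c + 2 * β * s + α * s ^ 2 :=
    Handoff.re_weilQuadratic_add_real_mul hψ hv s
  have hfu0 : 0 ≤ (weilQuadratic u).re := by
    rw [hfu]
    have h1 : -(2 * |β| * s) ≤ 2 * β * s := by nlinarith [neg_abs_le β, hs0.le]
    have hss : s ^ 2 ≤ s := by nlinarith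
    have h2a : -|α| * s ^ 2 ≤ α * s ^ 2 := mul_le_mul_of_nonneg_right (neg_abs_le α) (sq_nonneg s)
    have h2b : |α| * s ^ 2 ≤ |α| * s := mul_le_mul_of_nonneg_left hss (abs_nonneg α)
    have h2 : -(|α| * s) ≤ α * s ^ 2 := by linarith
    nlinarith
  -- the repaired law at (u, ψ)
  have key := hC (Real.log q' / 2) ⟨hle, le_rfl⟩ u ψ hu hus hfu0 hψedge
  have hcross : Handoff.crossRe u ψ = c + s * β := crossRe_add_real_mul_self hψ hv s
  rw [hcross, hfu] at key
  -- (c + sβ)² ≤ (c + 2βs + αs²)c  ⟹  β²s² ≤ αcs² < 0·… : absurd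
  nlinarith [sq_nonneg β, mul_pos hs0 hs0, mul_pos hc (mul_pos hs0 hs0),
    mul_pos (mul_pos hc (neg_pos.2 hneg)) (mul_pos hs0 hs0)]

/-- **`CouplingPos(q) ↔ H(q)`** (consecutive primes, overlap `0 < η < (log q)/2`): the repair collapses onto the
original. [this track (theory-1 gen2)] -/
theorem handoffCouplingPos_iff_handoffH (hcons : Handoff.ConsecutivePrimes q q') (hη : 0 < η)
    (hη' : η < Real.log q / 2) : HandoffCouplingPos q q' η ↔ Handoff.HandoffH q q' := by
  rw [← handoffCoupling_iff_handoffH hcons hη hη']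
  refine ⟨fun h ↦ ?_, handoffCouplingPos_of_handoffCoupling⟩
  exact (handoffCouplingPos_iff_handoffCoupling_of_weilPositivityOn
    (weilPositivityOn_of_handoffCouplingPos hcons.1.two_le hcons.2.2.1 hη h)).1 h

/-- Hence also `RH ↔ ∀ q prime, CouplingPos(q, q⁺, η_q)` for every admissible schedule. [this track (theory-1 gen2)] -/
theorem riemannHypothesis_iff_forall_handoffCouplingPos {η : ℕ → ℝ}
    (hη : ∀ q : ℕ, q.Prime → 0 < η q ∧ η q < Real.log q / 2) :
    Summit.RiemannHypothesis ↔ ∀ q : ℕ, q.Prime → HandoffCouplingPos q (nextPrime q) (η q) := by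
  rw [riemannHypothesis_iff_forall_handoffH]
  refine forall_congr' fun q ↦ forall_congr' fun hq ↦ ?_
  exact (handoffCouplingPos_iff_handoffH (consecutivePrimes_nextPrime hq) (hη q hq).1 (hη q hq).2).symm

end Summit.RiemannHypothesis.RiemannHypothesis.Theorems.HandoffDecomposition

end
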